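/-
Copyright: statement-level skeleton of a published paper (lit-balaban cell, Phase-2 proof seat p26 gen 41). No claims beyond
what the kernel checks below.
-/
import Mathlib
import Literature.MathematicalPhysics.QuantumFieldTheory.Balaban1983to89.B3GraphAmplitudeRules
import Literature.MathematicalPhysics.QuantumFieldTheory.Balaban1983to89.B3Eq36TadpoleExpressions

/-!
# B3 — T. Bałaban, *(Higgs)₂,₃ quantum fields in a finite volume. III. Renormalization*, CMP **88** (1983) 411–445
[Balaban1983Higgs3] — pp. 425–427: **THE EVALUATOR MAJORIZED TERMWISE** — the bookkeeping first step of every estimate of a graph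
expression in print ((2.10) p. 426 for the propagators, (2.13) p. 427 for E(G′)): the finite sum over index assignments `E(G; V, K, Φ)`
of FILE 1 (`B3GraphAmplitude.amp`) is dominated in absolute value by THE SAME SUM run on termwise majorants of the vertex rules, the line
kernels and the external data (`abs_amp_le`), hence FILE 2's concrete `graphAmp` by `amp` of any majorants of the printed rules on
basis fields (`abs_graphAmp_le`); and the three printed INGREDIENTS of the vertex majorants — `|U| = 1`, `|q| ≤ 1`, one factor `η⁻¹`
per difference quotient — as norm bounds on the typer's `covDeriv` of a basis field (§3), assembled into MAJORANT RULES for the polarized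
vertices (1.8)_{n,n′} and (1.10)_{n,n′} of FILE 2 (§4: `|rule18 …| ≤ …`, `|rule110 …| ≤ …` — the vertices of all ten lowest-order pictures
of §3 of print).  FILE 9 of the evaluator lineage: item 5 («the (2.13) majorant bridge») of `HOME/lit-balaban-p26/DESIGN-B3-evaluator.md`,
its abstract half 7a; the instantiation of p19's `B3Ineq213Amplitude.Amp` majorants from a graph (7b) is NOT done here

statement-level skeleton of published theorems with citation tags; proofs where landed; nothing here is a claim about
the Yang–Mills mass gap

PDF held: `paper:balaban1983-higgs-2-3-quantum-fields-finite-volume` (journal page = PDF page + 410); pp. 425–427 [PDF 15–17] (Prop.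
2.1 (2.10), (2.13)) as cited by FILEs 1–2 and by p19's `B3Ineq213Amplitude` / `B3Prop21Uniform`; p. 605 of [Balaban1982Higgs1] (*"unitary
operators on R^N … q is an antisymmetric N × N matrix, |q| ≦ 1"*) through the typer's `HiggsLattice.ChargeData.{U_mem_unitary, norm_q_le}`.

CITATION HEADER (lean-in-tree rule).  lit-balaban TYPED SKELETON (HOME `run/shared/lean/pub/lit-balaban/`), PHASE 2, seat p26 gen 41
(unit `lit-balaban-p26`; the evaluator lineage FILE 1 `B3GraphAmplitude` p361338, FILE 2 `B3GraphAmplitudeRules` p362438, FILE 3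
`B3Eq36TadpoleExpressions` p363523); free-target protocol G.5-34(d) (own lane; announced in HOME/STATUS.md).  ROWS **B3.Prop2.1-2.2** /
**B3.Eq2.13** / **B3.Prop1** of `HOME/lit-balaban-r15/ROWS-B3.md` (fold owner r15; heads by p19 / r15; this file is an OPTIONAL located
member, zero head weight: the bookkeeping half of «|E(G)| ≤ E of the majorants» on the concrete evaluator).  CONSUMES BY NAME, nothing
re-declared: FILE 1's `Rules`, `vertexFactor`, `sLineFactor`, `vLineFactor`, `oLineFactor`, `OutPairing`, `amp`; FILE 2's `Model`, `Loc`,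
`rulesOf`, `basisE`, `basisV`, `graphAmp`, `rule18`, `rule110`, `pleg18`, `pleg110`, `vlegs`; FILE 3's `basisE_eq`; the typer's `HiggsLattice.{ChargeData, ChargeData.U, U_mem_unitary,
norm_q_le, covDeriv, mesh_pos}`; Mathlib's `ContinuousLinearMap.norm_map_of_mem_unitary`, `PiLp.norm_single`.

READING (declared).  (a) «Majorant» = termwise domination in absolute value of each datum by a real-valued datum OF THE SAME SHAPE
(a vertex rule by a vertex rule, a kernel by a kernel, a joint external component function by one); the dominating expression is FILE
1's `amp` itself on the majorants — no separate «absolute evaluator» is introduced.  (b) The vertex majorants are functionals of the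
same leg fields; on the concrete evaluator they are needed ON BASIS FIELDS only (that is how `graphAmp` evaluates the rules), which is
where §3's norm bounds enter.  (c) §3 states print's three ingredients at the level of one differentiated basis leg: `‖U(B̃_b)v‖ = ‖v‖`,
`‖qu‖ ≤ ‖u‖`, `‖(D^η_B̃δ_p)(b)‖ ≤ η⁻¹([b₊ = p.1] + [b₋ = p.1])`; assembling them into majorant RULES for (1.6)–(1.15) and into p19's
`Amp.E` is the analytic half (7b), not here.

WHAT IS TYPED / PROVED (theorems only; no definition, no `Prop` fact, no `sorry`; standard axioms).  §1 `abs_vertexFactor_le`,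
`abs_sLineFactor_le`, `abs_vLineFactor_le`, `abs_oLineFactor_le`, **`abs_amp_le`** (`|amp V … K … Φ A Ψ| ≤ amp V′ … K′ … Φ′ A′ Ψ′` under
termwise `|·| ≤ ·′`), `amp_mono` (monotone in nonnegative data); §2 **`abs_graphAmp_le`** (`|graphAmp G M dm2 loc Po Ks Kv Ko Φ A Ψ| ≤ amp V′
basisE basisV basisE Po Ks′ Kv′ Ko′ Φ′ A′ Ψ′` whenever `|rulesOf G M dm2 loc i f g h| ≤ V′ i f g h` and the kernels/data are majorized),
`abs_graphAmp_le_abs` (with the absolute values themselves); §3 `norm_U_apply` (`‖U v‖ = ‖v‖`), `norm_q_apply_le` (`‖qu‖ ≤ ‖u‖`),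
`norm_basisE_apply`, **`norm_covDeriv_basisE_le`** (`‖(D^η_B̃δ_p)(b)‖ ≤ η⁻¹([b₊ = p.1] + [b₋ = p.1])`, any `B̃`),
**`abs_inner_covDeriv_basisE_q_le`** (`|(D^η_B̃δ_p)(b)·qu| ≤ η⁻¹([b₊ = p.1] + [b₋ = p.1])‖u‖`); §4 `norm_qpow_apply_le` (`‖q^m u‖ ≤ ‖u‖`),
`abs_pleg18_le`, `abs_pleg110_le`, `abs_vlegs`, `abs_coef18`, `abs_coef110`, **`abs_rule18_le`** (`|rule18 C g B̃ Ã n n′ S w f a| ≤ |e|^{n+n′}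
η^{n+n′−1}/(n!n′!) Σ_{b∈S} |w b| η^d ‖(D^η_B̃f₀)(b)‖‖f₁(b₋)‖ Π_j|g(b₋)||a_j(b)| |Ã(b)|^{n′}`), **`abs_rule110_le`** (the same with `‖f₀(b₋)‖`
and `η^{n+n′−2}`).
HONEST SCOPE.  (a) Bookkeeping (triangle inequality over finite sums and products) plus three one-line norm facts; nothing of Prop.
2.1/2.2's analysis, no (2.10) kernel bound, no tree-length or localization-cube bookkeeping of (2.13) — those are p19's / r15's files and
the future 7b.  (b) No claim that print organizes its estimates through this lemma; it is the form in which THIS lineage's evaluator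
meets p19's majorant family.  Unit `lit-balaban-p26` gen 41 (literature-prover-lit-balaban-p26-g41-0), HOME `run/shared/lean/pub/lit-balaban/`,
2026-08-23.  v1.1 (gen 42, literature-prover-lit-balaban-p26-g42-0) DOC-ONLY, referee ref-4 D-g72-3: the display (2.10) is on p. 426
[PDF 16] (three cite tags and the header corrected from «p. 425»), and the p. 426 sentence is now quoted verbatim (*"We estimate it taking
absolute values of all factors."*) in place of a paraphrase; declarations unchanged.
-/

open Finset
open scoped BigOperators

namespace Literature.MathematicalPhysics.QuantumFieldTheory.Balaban1983to89.B3GraphAmplitudeMajorant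

open Literature.MathematicalPhysics.QuantumFieldTheory.Balaban1983to89.B3Cor23Concrete (Graph)
open Literature.MathematicalPhysics.QuantumFieldTheory.Balaban1983to89.B3GraphAmplitude
open Literature.MathematicalPhysics.QuantumFieldTheory.Balaban1983to89.B3GraphAmplitudeRules

noncomputable section

/-! ## §1 The evaluator is dominated by the evaluator of termwise majorants -/

section Abstract

variable {nbar : ℕ} {G : Graph nbar} {SF VF OF : Type*} {IS IV IO : Type*}

/-- kernel: a product is dominated in absolute value by the product of termwise majorants. [folklore] -/
private theorem abs_prod_le {ι : Type*} [Fintype ι] (f g : ι → ℝ) (h : ∀ i, |f i| ≤ g i) : |∏ i, f i| ≤ ∏ i, g i := by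
  rw [Finset.abs_prod]
  exact Finset.prod_le_prod (fun i _ => abs_nonneg _) fun i _ => h i

/-- A MAJORANT of the vertex rules (`|V_i(f, g, h)| ≤ V′_i(f, g, h)` for every vertex and all leg fields) majorizes the vertex factor
at every index assignment. [cite: Balaban1983Higgs3, (2.13) p.427] -/
theorem abs_vertexFactor_le (V V' : Rules G SF VF OF) (hV : ∀ i f g h, |V i f g h| ≤ V' i f g h) (bS : IS → SF) (bV : IV → VF)
    (bO : IO → OF) (α : SLeg G.kind → IS) (β : VLeg G.kind → IV) (ο : OLeg G.kind → IO) :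
    |vertexFactor V bS bV bO α β ο| ≤ vertexFactor V' bS bV bO α β ο :=
  abs_prod_le _ _ fun i => hV i _ _ _

/-- Termwise majorants of the scalar line kernels majorize the scalar line factor. [cite: Balaban1983Higgs3, (2.13) p.427] -/
theorem abs_sLineFactor_le (Ks Ks' : SLine G → IS → IS → ℝ) (h : ∀ l p p', |Ks l p p'| ≤ Ks' l p p') (α : SLeg G.kind → IS) :
    |sLineFactor Ks α| ≤ sLineFactor Ks' α :=
  abs_prod_le _ _ fun l => h l _ _

/-- Termwise majorants of the vector line kernels majorize the vector line factor. [cite: Balaban1983Higgs3, (2.13) p.427] -/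
theorem abs_vLineFactor_le (Kv Kv' : VLine G → IV → IV → ℝ) (h : ∀ l b b', |Kv l b b'| ≤ Kv' l b b') (β : VLeg G.kind → IV) :
    |vLineFactor Kv β| ≤ vLineFactor Kv' β :=
  abs_prod_le _ _ fun l => h l _ _

/-- Termwise majorants of the output-pair kernels majorize the output-pair factor. [cite: Balaban1983Higgs3, (1.18) p.415] -/
theorem abs_oLineFactor_le (Po : OutPairing G) (Ko Ko' : Po.Line oRank → IO → IO → ℝ) (h : ∀ l r r', |Ko l r r'| ≤ Ko' l r r')
    (ο : OLeg G.kind → IO) : |oLineFactor Po Ko ο| ≤ oLineFactor Po Ko' ο :=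
  abs_prod_le _ _ fun l => h l _ _

/-- kernel: the seven-factor product of the evaluator's summand is dominated by the product of majorants. [folklore] -/
private theorem abs_mul7_le {v Φ A Ψ s w o v' Φ' A' Ψ' s' w' o' : ℝ} (hv : |v| ≤ v') (hΦ : |Φ| ≤ Φ') (hA : |A| ≤ A') (hΨ : |Ψ| ≤ Ψ')
    (hs : |s| ≤ s') (hw : |w| ≤ w') (ho : |o| ≤ o') :
    |v * (Φ * A * Ψ) * (s * w * o)| ≤ v' * (Φ' * A' * Ψ') * (s' * w' * o') := by
  rw [abs_mul, abs_mul, abs_mul, abs_mul, abs_mul, abs_mul]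
  have h0 : ∀ {x y : ℝ}, |x| ≤ y → 0 ≤ y := fun h => (abs_nonneg _).trans h
  refine mul_le_mul (mul_le_mul hv ?_ (by positivity) (h0 hv)) ?_ (by positivity) (mul_nonneg (h0 hv) ?_)
  · exact mul_le_mul (mul_le_mul hΦ hA (abs_nonneg _) (h0 hΦ)) hΨ (abs_nonneg _) (mul_nonneg (h0 hΦ) (h0 hA))
  · exact mul_le_mul (mul_le_mul hs hw (abs_nonneg _) (h0 hs)) ho (abs_nonneg _) (mul_nonneg (h0 hs) (h0 hw))
  · exact mul_nonneg (mul_nonneg (h0 hΦ) (h0 hA)) (h0 hΨ)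

variable [Fintype IS] [Fintype IV] [Fintype IO]

/-- **THE EVALUATOR IS DOMINATED BY THE EVALUATOR OF THE MAJORANTS** (the first, bookkeeping step of every estimate of a graph
expression in print — (2.10), (2.13); p. 426: *"We estimate it taking absolute values of all factors."*): if the vertex
rules, the three families of line kernels and the three external data are majorized termwise in absolute value by `V′`, `Ks′`, `Kv′`,
`Ko′`, `Φ′`, `A′`, `Ψ′`, then `|E(G; V, K, Φ)| ≤ E(G; V′, K′, Φ′)` — the same finite sum over index assignments with the majorants in
place of the data (FILE 1's `amp` is its own majorant evaluator). [cite: Balaban1983Higgs3, (2.13) p.427] [cite: Balaban1983Higgs3, (2.10) p.426] -/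
theorem abs_amp_le (V V' : Rules G SF VF OF) (hV : ∀ i f g h, |V i f g h| ≤ V' i f g h) (bS : IS → SF) (bV : IV → VF) (bO : IO → OF)
    (Po : OutPairing G) (Ks Ks' : SLine G → IS → IS → ℝ) (hKs : ∀ l p p', |Ks l p p'| ≤ Ks' l p p')
    (Kv Kv' : VLine G → IV → IV → ℝ) (hKv : ∀ l b b', |Kv l b b'| ≤ Kv' l b b')
    (Ko Ko' : Po.Line oRank → IO → IO → ℝ) (hKo : ∀ l r r', |Ko l r r'| ≤ Ko' l r r')
    (Φ Φ' : (ExtSLeg G → IS) → ℝ) (hΦ : ∀ γ, |Φ γ| ≤ Φ' γ) (A A' : (ExtVLeg G → IV) → ℝ) (hA : ∀ ζ, |A ζ| ≤ A' ζ)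
    (Ψ Ψ' : (Po.Ext → IO) → ℝ) (hΨ : ∀ ξ, |Ψ ξ| ≤ Ψ' ξ) :
    |amp V bS bV bO Po Ks Kv Ko Φ A Ψ| ≤ amp V' bS bV bO Po Ks' Kv' Ko' Φ' A' Ψ' := by
  unfold amp
  refine (Finset.abs_sum_le_sum_abs _ _).trans (Finset.sum_le_sum fun α _ => ?_)
  refine (Finset.abs_sum_le_sum_abs _ _).trans (Finset.sum_le_sum fun β _ => ?_)
  refine (Finset.abs_sum_le_sum_abs _ _).trans (Finset.sum_le_sum fun ο _ => ?_)
  exact abs_mul7_le (abs_vertexFactor_le V V' hV bS bV bO α β ο) (hΦ _) (hA _) (hΨ _) (abs_sLineFactor_le Ks Ks' hKs α)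
    (abs_vLineFactor_le Kv Kv' hKv β) (abs_oLineFactor_le Po Ko Ko' hKo ο)

/-- The majorant evaluator is MONOTONE in nonnegative data: enlarging nonnegative majorants enlarges the bound (so cruder, uniform
majorants may replace sharp ones). [cite: Balaban1983Higgs3, (2.13) p.427] -/
theorem amp_mono (V V' : Rules G SF VF OF) (hV0 : ∀ i f g h, 0 ≤ V i f g h) (hV : ∀ i f g h, V i f g h ≤ V' i f g h)
    (bS : IS → SF) (bV : IV → VF) (bO : IO → OF) (Po : OutPairing G)
    (Ks Ks' : SLine G → IS → IS → ℝ) (hKs0 : ∀ l p p', 0 ≤ Ks l p p') (hKs : ∀ l p p', Ks l p p' ≤ Ks' l p p')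
    (Kv Kv' : VLine G → IV → IV → ℝ) (hKv0 : ∀ l b b', 0 ≤ Kv l b b') (hKv : ∀ l b b', Kv l b b' ≤ Kv' l b b')
    (Ko Ko' : Po.Line oRank → IO → IO → ℝ) (hKo0 : ∀ l r r', 0 ≤ Ko l r r') (hKo : ∀ l r r', Ko l r r' ≤ Ko' l r r')
    (Φ Φ' : (ExtSLeg G → IS) → ℝ) (hΦ0 : ∀ γ, 0 ≤ Φ γ) (hΦ : ∀ γ, Φ γ ≤ Φ' γ) (A A' : (ExtVLeg G → IV) → ℝ) (hA0 : ∀ ζ, 0 ≤ A ζ)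
    (hA : ∀ ζ, A ζ ≤ A' ζ) (Ψ Ψ' : (Po.Ext → IO) → ℝ) (hΨ0 : ∀ ξ, 0 ≤ Ψ ξ) (hΨ : ∀ ξ, Ψ ξ ≤ Ψ' ξ) :
    amp V bS bV bO Po Ks Kv Ko Φ A Ψ ≤ amp V' bS bV bO Po Ks' Kv' Ko' Φ' A' Ψ' := by
  have h := abs_amp_le V V' (fun i f g h => by rw [abs_of_nonneg (hV0 i f g h)]; exact hV i f g h) bS bV bO Po Ks Ks'
    (fun l p p' => by rw [abs_of_nonneg (hKs0 l p p')]; exact hKs l p p') Kv Kv' (fun l b b' => by rw [abs_of_nonneg (hKv0 l b b')]; exact hKv l b b')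
    Ko Ko' (fun l r r' => by rw [abs_of_nonneg (hKo0 l r r')]; exact hKo l r r') Φ Φ' (fun γ => by rw [abs_of_nonneg (hΦ0 γ)]; exact hΦ γ)
    A A' (fun ζ => by rw [abs_of_nonneg (hA0 ζ)]; exact hA ζ) Ψ Ψ' (fun ξ => by rw [abs_of_nonneg (hΨ0 ξ)]; exact hΨ ξ)
  exact (le_abs_self _).trans h

end Abstract

/-! ## §2 On the concrete evaluator of FILE 2 -/

section Concrete

variable {P : HiggsLattice.Params} {N k nbar : ℕ} {G : Graph nbar} [DecidableEq (HiggsLattice.PBond P 0)]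

/-- **`|E(G,{□(v)},Φ_ext,A_ext)| ≤ E_maj`**: the concrete expression of FILE 2 (the printed vertices (1.6)–(1.15) with their couplings,
`Ã`, `B̃`, `g_k` and localization weights, on the coordinate bases) is dominated by FILE 1's evaluator run on ANY termwise majorants of
the polarized vertex rules ON BASIS FIELDS, of the line kernels and of the external data — the form in which (2.13) is applied to a
graph (the majorants of print: Proposition 2.1's kernel bounds (2.10) for the lines, `|q| ≤ 1`, `|U| = 1`, sup norms of the fields
and `Σ_{b} |w(b)| …` for the vertices; supplying them is the analytic step, not done here). [cite: Balaban1983Higgs3, (2.13) p.427]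
[cite: Balaban1983Higgs3, p.420] -/
theorem abs_graphAmp_le (M : Model P N k) (dm2 : Fin G.nV → HiggsLattice.Site P 0 → ℝ) (loc : Fin G.nV → Loc P k)
    (V' : Rules G (HiggsLattice.ScalarField P 0 N) (HiggsLattice.VecField P 0) (HiggsLattice.ScalarField P k N))
    (hV : ∀ i f g h, |rulesOf G M dm2 loc i f g h| ≤ V' i f g h) (Po : OutPairing G)
    (Ks Ks' : SLine G → HiggsLattice.Site P 0 × Fin N → HiggsLattice.Site P 0 × Fin N → ℝ) (hKs : ∀ l p p', |Ks l p p'| ≤ Ks' l p p')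
    (Kv Kv' : VLine G → HiggsLattice.PBond P 0 → HiggsLattice.PBond P 0 → ℝ) (hKv : ∀ l b b', |Kv l b b'| ≤ Kv' l b b')
    (Ko Ko' : Po.Line oRank → HiggsLattice.Site P k × Fin N → HiggsLattice.Site P k × Fin N → ℝ) (hKo : ∀ l r r', |Ko l r r'| ≤ Ko' l r r')
    (Φ Φ' : (ExtSLeg G → HiggsLattice.Site P 0 × Fin N) → ℝ) (hΦ : ∀ γ, |Φ γ| ≤ Φ' γ)
    (A A' : (ExtVLeg G → HiggsLattice.PBond P 0) → ℝ) (hA : ∀ ζ, |A ζ| ≤ A' ζ)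
    (Ψ Ψ' : (Po.Ext → HiggsLattice.Site P k × Fin N) → ℝ) (hΨ : ∀ ξ, |Ψ ξ| ≤ Ψ' ξ) :
    |graphAmp G M dm2 loc Po Ks Kv Ko Φ A Ψ| ≤ amp V' basisE basisV basisE Po Ks' Kv' Ko' Φ' A' Ψ' :=
  abs_amp_le _ V' hV basisE basisV basisE Po Ks Ks' hKs Kv Kv' hKv Ko Ko' hKo Φ Φ' hΦ A A' hA Ψ Ψ' hΨ

/-- In particular with the majorants `|V|`, `|K|`, `|Φ|` themselves (the sum of the absolute values of the summands).
[cite: Balaban1983Higgs3, (2.13) p.427] -/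
theorem abs_graphAmp_le_abs (M : Model P N k) (dm2 : Fin G.nV → HiggsLattice.Site P 0 → ℝ) (loc : Fin G.nV → Loc P k) (Po : OutPairing G)
    (Ks : SLine G → HiggsLattice.Site P 0 × Fin N → HiggsLattice.Site P 0 × Fin N → ℝ)
    (Kv : VLine G → HiggsLattice.PBond P 0 → HiggsLattice.PBond P 0 → ℝ)
    (Ko : Po.Line oRank → HiggsLattice.Site P k × Fin N → HiggsLattice.Site P k × Fin N → ℝ)
    (Φ : (ExtSLeg G → HiggsLattice.Site P 0 × Fin N) → ℝ) (A : (ExtVLeg G → HiggsLattice.PBond P 0) → ℝ)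
    (Ψ : (Po.Ext → HiggsLattice.Site P k × Fin N) → ℝ) :
    |graphAmp G M dm2 loc Po Ks Kv Ko Φ A Ψ| ≤
      amp (fun i f g h => |rulesOf G M dm2 loc i f g h|) basisE basisV basisE Po (fun l p p' => |Ks l p p'|) (fun l b b' => |Kv l b b'|)
        (fun l r r' => |Ko l r r'|) (fun γ => |Φ γ|) (fun ζ => |A ζ|) (fun ξ => |Ψ ξ|) :=
  abs_graphAmp_le M dm2 loc _ (fun _ _ _ _ => le_rfl) Po Ks _ (fun _ _ _ => le_rfl) Kv _ (fun _ _ _ => le_rfl) Ko _ (fun _ _ _ => le_rfl)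
    Φ _ (fun _ => le_rfl) A _ (fun _ => le_rfl) Ψ _ (fun _ => le_rfl)

end Concrete

/-! ## §3 The printed ingredients of the vertex majorants: `|U| = 1`, `|q| ≤ 1`, each difference quotient costs `η⁻¹` -/

section Ingredients

variable {P : HiggsLattice.Params} {N : ℕ}

open Literature.MathematicalPhysics.QuantumFieldTheory.Balaban1983to89.HiggsLattice (ChargeData covDeriv)
open Literature.MathematicalPhysics.QuantumFieldTheory.Balaban1983to89.B3Eq36TadpoleExpressions (basisE_eq)

/-- `|U| = 1`: the parallel transporter `U(ηeA) = exp(ηeA·q)` is norm-preserving (p. 605 *"unitary operators on R^N"*; the typer's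
`U_mem_unitary`). [cite: Balaban1982Higgs1, (1.7) p.605] -/
theorem norm_U_apply (C : ChargeData N) (η A : ℝ) (v : HiggsCovariance.E N) : ‖C.U η A v‖ = ‖v‖ :=
  ContinuousLinearMap.norm_map_of_mem_unitary (C.U_mem_unitary η A) v

/-- `|q| ≤ 1` on vectors: `‖qu‖ ≤ ‖u‖` (the typer's `norm_q_le`). [cite: Balaban1982Higgs1, (1.7) p.605] -/
theorem norm_q_apply_le (C : ChargeData N) (u : HiggsCovariance.E N) : ‖C.q u‖ ≤ ‖u‖ :=
  (C.q.le_opNorm u).trans (by nlinarith [C.norm_q_le, norm_nonneg u])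

/-- the basis field `δ_p` has norm `[x = p.1]` at the site `x`. [cite: Balaban1983Higgs3, p.414] -/
theorem norm_basisE_apply (p : HiggsLattice.Site P 0 × Fin N) (x : HiggsLattice.Site P 0) :
    ‖basisE p x‖ = if x = p.1 then 1 else 0 := by
  rw [basisE_eq]
  split_ifs
  · rw [PiLp.norm_single, norm_one]
  · exact norm_zero

/-- **Each differentiated leg costs `η⁻¹`**: `‖(D^η_B̃ δ_p)(b)‖ ≤ η⁻¹([b₊ = p.1] + [b₋ = p.1])` at ANY background (`|U(B̃_b)| = 1`) — the
factor `η^{−1}` per difference quotient of the vertex estimates behind (2.10)/(2.13). [cite: Balaban1983Higgs3, (2.10) p.426]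
[cite: Balaban1982Higgs1, (1.7) p.605] -/
theorem norm_covDeriv_basisE_le (C : ChargeData N) (B : HiggsLattice.VecField P 0) (p : HiggsLattice.Site P 0 × Fin N) (b : HiggsLattice.PBond P 0) :
    ‖covDeriv C B (basisE p) b‖ ≤ (P.mesh 0)⁻¹ * ((if b.tgt = p.1 then (1 : ℝ) else 0) + (if b.src = p.1 then (1 : ℝ) else 0)) := by
  have hη : 0 ≤ (P.mesh 0)⁻¹ := inv_nonneg.2 (P.mesh_pos 0).le
  unfold HiggsLattice.covDeriv
  rw [norm_smul, Real.norm_of_nonneg hη]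
  refine mul_le_mul_of_nonneg_left ((norm_sub_le _ _).trans ?_) hη
  rw [norm_U_apply, norm_basisE_apply, norm_basisE_apply]

/-- **… and `|q| ≤ 1`**: the component `(D^η_B̃ δ_p)(b)·(qu)` through which a differentiated φ′-leg meets the charge matrix (FILE 5's
`dq` for `u = e_c`) is bounded by `η⁻¹([b₊ = p.1] + [b₋ = p.1])‖u‖`. [cite: Balaban1983Higgs3, (2.10) p.426] [cite: Balaban1982Higgs1, (1.7) p.605] -/
theorem abs_inner_covDeriv_basisE_q_le (C : ChargeData N) (B : HiggsLattice.VecField P 0) (p : HiggsLattice.Site P 0 × Fin N)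
    (b : HiggsLattice.PBond P 0) (u : HiggsCovariance.E N) :
    |inner ℝ (covDeriv C B (basisE p) b) (C.q u)| ≤
      (P.mesh 0)⁻¹ * ((if b.tgt = p.1 then (1 : ℝ) else 0) + (if b.src = p.1 then (1 : ℝ) else 0)) * ‖u‖ :=
  (abs_real_inner_le_norm _ _).trans
    (mul_le_mul (norm_covDeriv_basisE_le C B p b) (norm_q_apply_le C u) (norm_nonneg _)
      (mul_nonneg (inv_nonneg.2 (P.mesh_pos 0).le) (by positivity)))

end Ingredients

/-! ## §4 The majorant RULES of (1.8) and (1.10) (polarized; the vertices of all ten lowest-order pictures of §3 of print) -/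

section MajorantRules

variable {P : HiggsLattice.Params} {N k : ℕ}

open Literature.MathematicalPhysics.QuantumFieldTheory.Balaban1983to89.HiggsLattice (ChargeData covDeriv)

/-- `|q^m| ≤ 1` on vectors: `‖q^m u‖ ≤ ‖u‖`. [cite: Balaban1982Higgs1, (1.7) p.605] -/
theorem norm_qpow_apply_le (C : ChargeData N) : ∀ (m : ℕ) (u : HiggsCovariance.E N), ‖(C.q ^ m) u‖ ≤ ‖u‖
  | 0, u => le_of_eq (by rw [pow_zero]; rfl)
  | m + 1, u => by
      rw [pow_succ]
      exact (norm_qpow_apply_le C m (C.q u)).trans (norm_q_apply_le C u)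

/-- The polarized bracket of (1.8) is bounded by the norms of its two legs: `|(D^η_B̃f₀)(b)·q^m f₁(b₋)| ≤ ‖(D^η_B̃f₀)(b)‖‖f₁(b₋)‖`.
[cite: Balaban1983Higgs3, (1.8) p.413] [cite: Balaban1982Higgs1, (1.7) p.605] -/
theorem abs_pleg18_le (C : ChargeData N) (B : HiggsLattice.VecField P k) (f₀ f₁ : HiggsLattice.ScalarField P k N) (m : ℕ) (b : HiggsLattice.PBond P k) :
    |pleg18 C B f₀ f₁ (C.q ^ m) b| ≤ ‖covDeriv C B f₀ b‖ * ‖f₁ b.src‖ :=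
  (abs_real_inner_le_norm _ _).trans (mul_le_mul_of_nonneg_left (norm_qpow_apply_le C m _) (norm_nonneg _))

/-- The polarized bracket of (1.10) is bounded by the norms of its two legs. [cite: Balaban1983Higgs3, (1.10) p.413] -/
theorem abs_pleg110_le (C : ChargeData N) (f₀ f₁ : HiggsLattice.ScalarField P k N) (m : ℕ) (b : HiggsLattice.PBond P k) :
    |pleg110 f₀ f₁ (C.q ^ m) b| ≤ ‖f₀ b.src‖ * ‖f₁ b.src‖ :=
  (abs_real_inner_le_norm _ _).trans (mul_le_mul_of_nonneg_left (norm_qpow_apply_le C m _) (norm_nonneg _))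

/-- the polarized A′-legs in absolute value. [cite: Balaban1983Higgs3, (1.8) p.413] -/
theorem abs_vlegs (g : HiggsLattice.Site P k → ℝ) {n : ℕ} (a : Fin n → HiggsLattice.VecField P k) (b : HiggsLattice.PBond P k) :
    |vlegs g a b| = ∏ j : Fin n, |g b.src| * |a j b| := by
  unfold vlegs
  rw [Finset.abs_prod]
  exact Finset.prod_congr rfl fun j _ => abs_mul _ _

/-- the numerical prefactor of (1.8)/(1.10) in absolute value: `|e^{n+n′}(−1)^{n+n′}η^{n+n′−1}/(n!n′!)| = |e|^{n+n′}η^{n+n′−1}/(n!n′!)`.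
[cite: Balaban1983Higgs3, (1.8) p.413] -/
theorem abs_coef18 (C : ChargeData N) (n n' : ℕ) :
    |C.e ^ (n + n') * ((-1 : ℝ) ^ (n + n') * P.mesh k ^ ((n + n' : ℤ) - 1) / ((n.factorial : ℝ) * n'.factorial))| =
      |C.e| ^ (n + n') * (P.mesh k ^ ((n + n' : ℤ) - 1) / ((n.factorial : ℝ) * n'.factorial)) := by
  rw [abs_mul, abs_pow, abs_div, abs_mul, abs_pow, abs_neg, abs_one, one_pow, one_mul,
    abs_of_pos (zpow_pos (P.mesh_pos k) _), abs_of_pos (by positivity : (0 : ℝ) < (n.factorial : ℝ) * n'.factorial)]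

/-- **THE MAJORANT RULE of (1.8)_{n,n′}** (polarized, any leg fields, any background): the printed vertex with every factor replaced
by its absolute value resp. norm bound dominates it —
`|V_(1.8)(f; a)| ≤ |e|^{n+n′} η^{n+n′−1}/(n!n′!) Σ_{b∈S} |w(b)| η^d ‖(D^η_B̃f₀)(b)‖ ‖f₁(b₋)‖ Π_j |g(b₋)||a_j(b)| |Ã(b)|^{n′}` (`|q| ≤ 1` used
`n+n′` times). [cite: Balaban1983Higgs3, (1.8) p.413] [cite: Balaban1983Higgs3, (2.13) p.427] -/
theorem abs_rule18_le (C : ChargeData N) (g : HiggsLattice.Site P k → ℝ) (B At : HiggsLattice.VecField P k) (n n' : ℕ)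
    (S : Finset (HiggsLattice.PBond P k)) (w : HiggsLattice.PBond P k → ℝ) (f : Fin 2 → HiggsLattice.ScalarField P k N)
    (a : Fin n → HiggsLattice.VecField P k) :
    |rule18 C g B At n n' S w f a| ≤
      |C.e| ^ (n + n') * (P.mesh k ^ ((n + n' : ℤ) - 1) / ((n.factorial : ℝ) * n'.factorial)) *
        ∑ b ∈ S, |w b| * (P.mesh k ^ P.d * (‖covDeriv C B (f 0) b‖ * ‖f 1 b.src‖) * (∏ j : Fin n, |g b.src| * |a j b|) * |At b| ^ n') := by
  unfold rule18
  rw [abs_mul, abs_coef18]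
  refine mul_le_mul_of_nonneg_left ((Finset.abs_sum_le_sum_abs _ _).trans (Finset.sum_le_sum fun b _ => ?_))
    (mul_nonneg (pow_nonneg (abs_nonneg _) _) (div_nonneg (zpow_nonneg (P.mesh_pos k).le _) (by positivity)))
  rw [abs_mul, abs_mul, abs_mul, abs_mul, abs_pow, abs_pow, abs_vlegs, abs_of_pos (P.mesh_pos k)]
  have h1 := abs_pleg18_le C B (f 0) (f 1) (n + n') b
  have h2 : 0 ≤ ∏ j : Fin n, |g b.src| * |a j b| := Finset.prod_nonneg fun j _ => mul_nonneg (abs_nonneg _) (abs_nonneg _)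
  refine mul_le_mul_of_nonneg_left ?_ (abs_nonneg _)
  exact mul_le_mul_of_nonneg_right (mul_le_mul_of_nonneg_right (mul_le_mul_of_nonneg_left h1 (pow_pos (P.mesh_pos k) _).le) h2) (pow_nonneg (abs_nonneg _) _)

/-- the numerical prefactor of (1.10) in absolute value: `|e^{n+n′}η^{n+n′−2}/(n!n′!)| = |e|^{n+n′}η^{n+n′−2}/(n!n′!)`.
[cite: Balaban1983Higgs3, (1.10) p.413] -/
theorem abs_coef110 (C : ChargeData N) (n n' : ℕ) :
    |C.e ^ (n + n') * (P.mesh k ^ ((n + n' : ℤ) - 2) / ((n.factorial : ℝ) * n'.factorial))| =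
      |C.e| ^ (n + n') * (P.mesh k ^ ((n + n' : ℤ) - 2) / ((n.factorial : ℝ) * n'.factorial)) := by
  rw [abs_mul, abs_pow, abs_div, abs_of_pos (zpow_pos (P.mesh_pos k) _),
    abs_of_pos (by positivity : (0 : ℝ) < (n.factorial : ℝ) * n'.factorial)]

/-- **THE MAJORANT RULE of (1.10)_{n,n′}**: `|V_(1.10)(f; a)| ≤ |e|^{n+n′} η^{n+n′−2}/(n!n′!) Σ_{b∈S} |w(b)| η^d ‖f₀(b₋)‖ ‖f₁(b₋)‖
Π_j |g(b₋)||a_j(b)| |Ã(b)|^{n′}`. [cite: Balaban1983Higgs3, (1.10) p.413] [cite: Balaban1983Higgs3, (2.13) p.427] -/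
theorem abs_rule110_le (C : ChargeData N) (g : HiggsLattice.Site P k → ℝ) (At : HiggsLattice.VecField P k) (n n' : ℕ)
    (S : Finset (HiggsLattice.PBond P k)) (w : HiggsLattice.PBond P k → ℝ) (f : Fin 2 → HiggsLattice.ScalarField P k N)
    (a : Fin n → HiggsLattice.VecField P k) :
    |rule110 C g At n n' S w f a| ≤
      |C.e| ^ (n + n') * (P.mesh k ^ ((n + n' : ℤ) - 2) / ((n.factorial : ℝ) * n'.factorial)) *
        ∑ b ∈ S, |w b| * (P.mesh k ^ P.d * (‖f 0 b.src‖ * ‖f 1 b.src‖) * (∏ j : Fin n, |g b.src| * |a j b|) * |At b| ^ n') := by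
  unfold rule110
  rw [abs_mul, abs_coef110]
  refine mul_le_mul_of_nonneg_left ((Finset.abs_sum_le_sum_abs _ _).trans (Finset.sum_le_sum fun b _ => ?_))
    (mul_nonneg (pow_nonneg (abs_nonneg _) _) (div_nonneg (zpow_nonneg (P.mesh_pos k).le _) (by positivity)))
  rw [abs_mul, abs_mul, abs_mul, abs_mul, abs_pow, abs_pow, abs_vlegs, abs_of_pos (P.mesh_pos k)]
  have h1 := abs_pleg110_le C (f 0) (f 1) (n + n') b
  have h2 : 0 ≤ ∏ j : Fin n, |g b.src| * |a j b| := Finset.prod_nonneg fun j _ => mul_nonneg (abs_nonneg _) (abs_nonneg _)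
  refine mul_le_mul_of_nonneg_left ?_ (abs_nonneg _)
  exact mul_le_mul_of_nonneg_right (mul_le_mul_of_nonneg_right (mul_le_mul_of_nonneg_left h1 (pow_pos (P.mesh_pos k) _).le) h2) (pow_nonneg (abs_nonneg _) _)

end MajorantRules

end

end Literature.MathematicalPhysics.QuantumFieldTheory.Balaban1983to89.B3GraphAmplitudeMajorant
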